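import Summits.Ventures.CertifiedManyBodySolver.Certificates.HubbardSquare_kdwidth_NM51A_V
import HarnessLib

/-!
# Ventures/CertifiedManyBodySolver — Certificates/HubbardSquare_kdwidth_NM51A.lean — KERNEL CHECKS + HEADLINE THEOREMS (hubbard-box-p2 g18, cell hubbard-fast: KD-WIDTH)

KD-WIDTH = the box-wide e₀-window WIDTH of a routed material box as a KERNEL THEOREM. HONEST FRAMING: bookkeeping only —
no new floor, no new cap, no number tighter than what the cited landed words give; what is added is the kernel-checked
statement that at EVERY point `θ = (U/t, t'/t, n)` of the box M51 «YBCO-Zn0.03» (U ['22/5', '57/5'] × t′ ['-63/100', '-11/25'] × n ['4/5', '17/20']) some pair (floor word,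
cap word) of the module's explicit word table brackets `e₀(1, t', U, n)` within width w = 6/25 = 0.2400·t, and that the
box-wide hull window is [-5721/5000, -6491/10000] = [-1.1442, -0.6491] (mode A: all landed two-sided word shapes; conditional on the 247 named premises of the cited words, bundled verbatim as `kdw_NM51A_Premises`).
FILE SET: `HubbardSquare_kdwidth_NM51A_T*.lean` (records, table, trees, premise bundle — statement-only), `HubbardSquare_kdwidth_NM51A_H<k>.lean` (per-word bridging lemmas),
`HubbardSquare_kdwidth_NM51A.lean` (kernel checks + headline theorems `kdw_NM51A_boxWidth` (PAIR form) / `kdw_NM51A_boxHull`). Device: Literature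
`BoxWidthCertificate` (p690455). POOL STAMP: pool-full-0315Z (meter-2 kit harvester v0.12, FULL re-harvest of the tree at 2026-08-29T03:15Z by this seat with the `((N : ℝ) / D)` literal style also accepted: 7936 const / 7503 multilinear / 634 affine / 4 ph-affine two-sided e₀ words).
ROW: hubbard-fast-meter-2 NNR-rows-v0.3.json (named-not-routed hull rows) row `M51` «YBCO-Zn0.03» (box literal above).
WHAT THIS IS NOT: a phase word; a new certified row; a statement about object M; a claim that `w` is optimal.

TARGETS: w = 6/25 (tight: best-first bound + 1e-4, rounded up); hull [-5721/5000, -6491/10000]. WIDTH tree 340 leaves (depth 20); HULL tree 212 leaves; 316 cited words (2 hypothesis-free, 314 with CANDIDATE-class premises).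
ARG-MAX LEAF (largest corner width among accepted leaves, 0.239992): box ['8', '-11/20', '13/16']–['44/5', '-1/2', '33/40'], floor `cw_YBCOE_M130Z_t55_50_E_q1c_mlword_Icc` [other; row literal by value], cap `cw_YBCOE_M130Z_t55_50_E_q1c_mlword_Icc` [other; row literal by value].
HEADLINE SHAPE (hubbard-fast-crit-1 S#150 / RULINGS #325): the PAIR form quantifies over the module's EXPLICIT table — the bracket is
computable from the table without knowing `e₀`, so the statement is false for a wrong `w`; the device's `exists_window_of_kdWidthCheck`
(∃ F C : ℝ …) is NOT used (that shape holds for any function).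
-/

noncomputable section

namespace Summit.Ventures.CertifiedManyBodySolver.Certificates

open Literature.MathematicalPhysics.QuantumLattice Literature.MathematicalPhysics.QuantumLattice.ThermodynamicLimit
open Matrix Finset Filter Topology
open Literature.MathematicalPhysics.QuantumLattice
open Literature.MathematicalPhysics.QuantumLattice.ThermodynamicLimit
open Literature.MathematicalPhysics.QuantumLattice.TTPrimeFree
open Literature.Probability.LatticeModels
open scoped ComplexOrder ComplexConjugate Topology BigOperators
open Summit.Ventures.CertifiedManyBodySolver.Certificates
open Summit.Ventures.CertifiedManyBodySolver.Certificates.BoxWordGC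
open Summit.Ventures.CertifiedManyBodySolver.Certificates.DerivedNTangentR473Sym
open Summit.Ventures.CertifiedManyBodySolver.Certificates.DerivedNTangentR504Sym
open Literature.Computation.Certificates.BoxCovering
open Literature.Analysis.ValidatedNumerics (KdCert)

/-- **Kernel check** (WIDTH tree): every leaf lies in its two cells and passes the exact corner tests. -/
theorem kdw_NM51A_checkW : kdw_NM51A_certW.check (widthLeaf kdw_NM51A_W (6/25) ((-1000)) (1000))
      (boxOfFn (![22/5, -63/100, 4/5] : Fin 3 → ℚ) ![57/5, -11/25, 17/20]) = true := by
  decide +kernel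

/-- **Kernel check** (HULL tree): every leaf lies in its two cells and passes the exact corner tests. -/
theorem kdw_NM51A_checkH : kdw_NM51A_certH.check (widthLeaf kdw_NM51A_W (1000) ((-5721/5000)) ((-6491/10000)))
      (boxOfFn (![22/5, -63/100, 4/5] : Fin 3 → ℚ) ![57/5, -11/25, 17/20]) = true := by
  decide +kernel

/-- **KD-WIDTH box word (M51 «YBCO-Zn0.03», mode A) — PAIR FORM.** At every point `θ = (U/t, t'/t, n)` of the box
`[22/5, 57/5] × [-63/100, -11/25] × [4/5, 17/20]` there is a pair `jk = (j, k)` of entries of the EXPLICIT table `kdw_NM51A_W` (316 landed words: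
rational cells, rational coordinatewise-affine floor / cap forms) whose cells contain `θ` and whose forms bracket the torus-limit
ground-state energy density, `F_j(θ) ≤ e₀(1, t', U, n) ≤ C_k(θ)`, with `C_k(θ) − F_j(θ) ≤ 6/25 = 0.2400`: the pool's best pointwise
certified window is nowhere on the box wider than `w` (340-leaf kd-tree; conditional on `kdw_NM51A_Premises`). [cite: Neumaier2004CompleteSearch, §12] -/
theorem kdw_NM51A_boxWidth (H : kdw_NM51A_Premises) :
    ∀ θ ∈ Set.Icc (![22/5, -63/100, 4/5] : Fin 3 → ℝ) ![57/5, -11/25, 17/20],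
      ∃ jk : Fin 316 × Fin 316,
        θ ∈ Set.Icc (fun i => (((kdw_NM51A_W jk.1).lo i : ℚ) : ℝ)) (fun i => (((kdw_NM51A_W jk.1).hi i : ℚ) : ℝ)) ∧
        θ ∈ Set.Icc (fun i => (((kdw_NM51A_W jk.2).lo i : ℚ) : ℝ)) (fun i => (((kdw_NM51A_W jk.2).hi i : ℚ) : ℝ)) ∧
        mlEval (kdw_NM51A_W jk.1).f θ ≤ energyDensityTT' 1 (θ 1) (θ 0) (θ 2) ∧ energyDensityTT' 1 (θ 1) (θ 0) (θ 2) ≤ mlEval (kdw_NM51A_W jk.2).c θ ∧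
        mlEval (kdw_NM51A_W jk.2).c θ - mlEval (kdw_NM51A_W jk.1).f θ ≤ (6/25 : ℝ) := by
  intro θ hθ
  have eL : (fun k : Fin 3 => (((![22/5, -63/100, 4/5] : Fin 3 → ℚ) k : ℚ) : ℝ)) = (![22/5, -63/100, 4/5] : Fin 3 → ℝ) := by funext k; fin_cases k <;> norm_num
  have eH : (fun k : Fin 3 => (((![57/5, -11/25, 17/20] : Fin 3 → ℚ) k : ℚ) : ℝ)) = (![57/5, -11/25, 17/20] : Fin 3 → ℝ) := by funext k; fin_cases k <;> norm_num
  obtain ⟨j, k, hj, hk, h₁, h₂, h₃, -, -⟩ := exists_pair_of_kdWidthCheck kdw_NM51A_W (fun θ : Fin 3 → ℝ => energyDensityTT' 1 (θ 1) (θ 0) (θ 2)) (kdw_NM51A_holds H) kdw_NM51A_checkW θ (by rw [eL, eH]; exact hθ)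
  refine ⟨(j, k), hj, hk, h₁, h₂, ?_⟩
  push_cast at h₃; linarith

/-- **KD-WIDTH hull word (M51 «YBCO-Zn0.03», mode A).** At every point of the box the energy density lies in
`[-5721/5000, -6491/10000] = [-1.1442, -0.6491]` (212-leaf kd-tree; conditional on `kdw_NM51A_Premises`). [cite: Neumaier2004CompleteSearch, §12] -/
theorem kdw_NM51A_boxHull (H : kdw_NM51A_Premises) :
    ∀ θ ∈ Set.Icc (![22/5, -63/100, 4/5] : Fin 3 → ℝ) ![57/5, -11/25, 17/20],
      (-5721/5000 : ℝ) ≤ energyDensityTT' 1 (θ 1) (θ 0) (θ 2) ∧ energyDensityTT' 1 (θ 1) (θ 0) (θ 2) ≤ (-6491/10000 : ℝ) := by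
  intro θ hθ
  have eL : (fun k : Fin 3 => (((![22/5, -63/100, 4/5] : Fin 3 → ℚ) k : ℚ) : ℝ)) = (![22/5, -63/100, 4/5] : Fin 3 → ℝ) := by funext k; fin_cases k <;> norm_num
  have eH : (fun k : Fin 3 => (((![57/5, -11/25, 17/20] : Fin 3 → ℚ) k : ℚ) : ℝ)) = (![57/5, -11/25, 17/20] : Fin 3 → ℝ) := by funext k; fin_cases k <;> norm_num
  obtain ⟨h₁, h₂⟩ := mem_Icc_of_kdWidthCheck kdw_NM51A_W (fun θ : Fin 3 → ℝ => energyDensityTT' 1 (θ 1) (θ 0) (θ 2)) (kdw_NM51A_holds H) kdw_NM51A_checkH θ (by rw [eL, eH]; exact hθ)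
  push_cast at h₁ h₂; exact ⟨by linarith, by linarith⟩

end Summit.Ventures.CertifiedManyBodySolver.Certificates

end
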